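import Summits.CriticalPhenomena.PercolationContinuityZ3.Theorems.PercNearOneGluingNoHeavyQuantHeavySingleStep
import HarnessLib

/-!
# QUANT lane R8, T-DEC: THE HEAVY-SINGLE SIBLING STEP REDUCES TO A ROOT-PATTERN MOMENT PROBLEM — ANY presentation of the opened compound
# as a mixture of admissible re-gated sub-forests closes the step (the balanced U-RPM of `…QuantHeavySingleStep` is ONE explicit solution),
# and the law identity is equivalent to finitely many PATTERN equations (arm-1 gen 53, architect)

builds on p205010 (kernel theorem, internal audit signed; external expert review pending)

Support file (`--supports stmt-CriticalPhenomena-4575`), QUANT lane seat prim-quant-arm-1 (gen 53, architect), rung R8 of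
`run/shared/lean/prim/quant/LADDER.md`; memo `run/shared/lean/prim/quant/prim-quant-arm-1-g53/ARCH-G53.md` §2–§3.  Theorems only, standard axioms,
no sorries.  Sequel of ✓ `…QuantHeavySingleStep` (`sdec_flaw_heavySingle_of_oracle`: the BALANCED case via census-1 g25's closed-form U-RPM
✓ `…QuantURPMIdentity/Lift/Law`).

WHY.  In the heavy-single orientation (`s :: L`, `q₁ = s.q`), arm-1 g45's two-root coupling with EQUAL gates `(q₁, q₁)` splits `gate_a (flaw (s :: L))`
into the free product part `gate_{aq₁} s.ρ ∗ gate_a (flaw L)` (two oracle calls + `convClosedT_holds`) and the U-part `gate_{aq₁}(s.ρ ∗ H)`,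
`H = (flaw L − (1−q₁)δ₀)/q₁` (arm-1 g52).  ANY identity `q₁·Σ_c λ_c · flaw (L|_{E_c}^{o^c}) = flaw L − (1−q₁)δ₀` with `λ ≥ 0`, `Σ λ = 1`, openness
`0 < o^c_i ≤ 1` on `E_c`, floors `x ≤ q₁·o^c_i·x₁ᵢ` and component means `≥ fmean L/q₁` makes every `gate_{aq₁}(s.ρ ∗ flaw (L|_{E_c}^{o^c}))` ONE oracle call at
the uniform floor `x/q₁` with the common target, so the step closes (`decAt_gate_flaw_heavySingle_of_mixture`, **`sdec_flaw_heavySingle_of_mixture`**).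
The balanced U-RPM (`E` ranging over all non-empty position sets, `λ = urpmW`, `o = openE`) is one solution; the identity itself is LINEAR in the
pattern laws `patLaw L A` (census-1's `flaw_pattern` / `flaw_subRegate`), hence implied by the `2^{|L|}` PATTERN EQUATIONS
  `q₁·Σ_c λ_c·[A ⊆ E_c]·Π_{i∈A} o^c_i·Π_{i∈E_c∖A}(1 − o^c_i) = Π_{i∈A} qᵢ·Π_{i∉A}(1 − qᵢ) − (1 − q₁)·[A = ∅]`
(**`mixture_identity_of_patterns`**) — a finite MOMENT PROBLEM for a mixing law on admissible openness vectors (**`sdec_flaw_heavySingle_of_patterns`**).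
WIDTH 3 (memo §3, exact arithmetic): the pattern law of two siblings is three moments; on the mean line `o₁m₁ + o₂m₂ = m*` a mixing law works iff
`E o₁ = q₁'/q₁` and `Var o₁ = (1 − q₁)·l₁l₂·m₂/m₁` (`lᵢ = qᵢ'/q₁`), so a TWO-POINT law exists iff that variance is at most `max (l₁ − a)(b − l₁)` over
admissible `a ≤ l₁ ≤ b` (atoms `oᵢ = 0` = sibling absent allowed): at the TRUE floor this covers 56.6 % of random heavy-orientation triples against
39.6 % for the balanced U-RPM (90.6 % with floor slack `x = ½·min qᵢyᵢ`); such rational two-point certificates are instances of this file with `|C| = 2`.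

HONEST STATUS.  A reduction + the abstract closing theorem; which unbalanced heavy singles admit admissible mixtures in general width is OPEN (a
moment problem; the U-RPM is its balanced vertex), as are `SiblingStep`, `GateStepN`, `LightResidDECOracle`, `FarTreeRow`; RATE class (log\*) and the
honest sentence of `run/shared/lean/prim/quant/README.md` unchanged.  [this work]; pattern expansion / `subRegate`: prim-quant-census-1 g25; two-root
identity: prim-quant-arm-1 g45.  Nothing here is cited as a published result.  The gluing rows served [cite: KozmaNitzan2024, Conjecture 3 (p. 15)];
product measure [cite: Grimmett1999, §1.3 p. 10].
-/

noncomputable section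

open scoped BigOperators

namespace Summit.CriticalPhenomena.PercolationContinuityZ3.Theorems
namespace Quant
namespace LawDec

open Finset URPM

/-! ### The heavy-single step from ANY admissible mixture presentation of the opened compound -/

/-- **THE HEAVY-SINGLE SIBLING STEP FROM AN ADMISSIBLE MIXTURE (DEC form).**  Floor `0 < x < 1`, tree-built `s :: L`, the oracle below
`fgates (s :: L)`; a finite family of components `c` — weights `λ_c ≥ 0` with `Σ λ = 1`, position sets `E_c`, openness `o^c` with `0 < o^c_i ≤ 1` and
the floor `x ≤ s.q·o^c_i·x₁ᵢ` on `E_c`, gated means `fmean L ≤ s.q · fmean (L|_{E_c}^{o^c})` (for the genuine components) — presenting the opened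
compound: `s.q·Σ_c λ_c·flaw (L|_{E_c}^{o^c}) = flaw L − (1 − s.q)·δ₀`.  THEN `gate (flaw (s :: L)) a` is DEC at floor `a·x` at every layer
`j < ftop (s :: L)`, for every outer gate `0 < a ≤ 1`. [this work] -/
theorem decAt_gate_flaw_heavySingle_of_mixture {x a : ℝ} (hx0 : 0 < x) (hx1 : x < 1) (s : Sib) (L : List Sib)
    (hs : s.TreeOK x) (hL : ∀ t ∈ L, t.TreeOK x)
    (hO : ∀ (x' : ℝ) (n' M' : ℕ) (μ' : ℕ → ℝ), n' < fgates (s :: L) → TreeBuiltN x' n' M' μ' → SDEC x' M' μ')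
    {C : Type*} [Fintype C] (lam : C → ℝ) (E : C → Finset (Fin L.length)) (o : C → Fin L.length → ℝ)
    (hlam0 : ∀ c, 0 ≤ lam c) (hlam1 : ∑ c, lam c = 1)
    (ho : ∀ c, 0 < lam c → ∀ i ∈ E c, 0 < o c i ∧ o c i ≤ 1 ∧ x ≤ s.q * (o c i * (L.get i).x₁))
    (hmean : ∀ c, 0 < lam c → fmean L ≤ s.q * fmean (subRegate L (E c) (o c)))
    (hmix : ∀ h, s.q * ∑ c, lam c * flaw (subRegate L (E c) (o c)) h = flaw L h - (1 - s.q) * (if h = 0 then 1 else 0))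
    (ha0 : 0 < a) (ha1 : a ≤ 1) :
    ∀ j, j < ftop (s :: L) → DECAt (a * x) j (ftop (s :: L)) (gate (flaw (s :: L)) a) := by
  classical
  intro j hj
  -- data of the single
  obtain ⟨hq0, hq1, hxq, hT, _⟩ := hs
  obtain ⟨hx₁0, hx₁1, ρ0, ρM, ρ1, ρta⟩ := hT.lawFacts
  set q₁ : ℝ := s.q with hq₁def
  have hL' : ∀ t ∈ L, t.LawOK := fun t ht => (hL t ht).lawOK
  have hsL : ∀ t ∈ s :: L, t.LawOK := by
    intro t ht
    rcases List.mem_cons.1 ht with rfl | ht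
    · exact ⟨hq0, hq1, ρ0, ρM, ρ1⟩
    · exact hL' t ht
  have hget : ∀ i : Fin L.length, (L.get i).TreeOK x := fun i => hL _ (List.get_mem L i)
  -- elementary bounds
  have haq0 : 0 < a * q₁ := mul_pos ha0 hq0
  have haq1 : a * q₁ < 1 := mul_lt_one_aux ha1 hq0.le hq1
  have hxq₁ : x < q₁ := lt_of_le_of_lt hxq (by nlinarith)
  set z : ℝ := a * x with hzdef
  have hz0 : 0 < z := mul_pos ha0 hx0
  have hz1 : z < 1 := by rw [hzdef]; nlinarith
  -- the uniform floor of the components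
  set v : ℝ := x / q₁ with hvdef
  have hv0 : 0 < v := div_pos hx0 hq0
  have hv1 : v < 1 := by rw [hvdef, div_lt_one hq0]; exact hxq₁
  have hvx₁ : v ≤ s.x₁ := by rw [hvdef, div_le_iff₀ hq0, mul_comm]; exact hxq
  have hzv : z = a * q₁ * v := by rw [hzdef, hvdef]; field_simp
  -- the common target
  set TE : ℝ := a * (q₁ * s.mean + fmean L) with hTEdef
  -- the mixture law and the components
  set cmp : C → List Sib := fun c => subRegate L (E c) (o c) with hcmpdef
  set Hmix : ℕ → ℝ := fun k => ∑ c, lam c * flaw (cmp c) k with hHmixdef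
  -- the compound IS the mixture gated by `q₁`
  have eHm : flaw L = gate Hmix q₁ := by
    funext h
    have key : q₁ * Hmix h = flaw L h - (1 - q₁) * (if h = 0 then 1 else 0) := hmix h
    rw [gate_apply]
    split_ifs with h0
    · rw [h0] at key ⊢; simp only [if_true, mul_one] at key; linarith
    · rw [if_neg h0, mul_zero, sub_zero] at key; linarith
  have htopE : ∀ c, ftop (cmp c) ≤ ftop L := fun c => ftop_subRegate_le L (E c) _
  have hgatesE : ∀ c, fgates (cmp c) ≤ fgates L := fun c => fgates_subRegate_le L (E c) _
  have HmixM : ∀ h, ftop L < h → Hmix h = 0 := by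
    intro h hh
    exact Finset.sum_eq_zero fun c _ => by rw [flaw_eq_zero_of_lt (cmp c) h (lt_of_le_of_lt (htopE c) hh), mul_zero]
  -- ORACLE CALLS.  (1) the opened single, (2) the compound forest
  have hS₁ : SDEC s.x₁ s.M s.ρ := hO s.x₁ s.n s.M s.ρ (by simp only [fgates]; omega) hT
  have hF : TreeBuiltN x (fgates L) (ftop L) (flaw L) := flaw_treeBuiltN hx0 hx1 L hL
  have hSL : SDEC x (ftop L) (flaw L) := hO x (fgates L) (ftop L) (flaw L) (by simp only [fgates]; omega) hF
  obtain ⟨f0, fM, f1, fmn⟩ := flaw_facts L hL'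
  obtain ⟨_, _, _, _, _, fta⟩ := hF.lawFacts
  -- term P: `gate_{a q₁} s.ρ ∗ gate_a (flaw L)` — ConvClosedT on two gated SDEC laws
  obtain ⟨g₁0, g₁M, g₁1⟩ := gate_laws s.M s.ρ (a * q₁) haq0.le haq1.le ρ0 ρM ρ1
  obtain ⟨g₂0, g₂M, g₂1⟩ := gate_laws (ftop L) (flaw L) a ha0.le ha1 f0 fM f1
  have hP : DECAtT z TE j (s.M + ftop L) (lconv s.M (ftop L) (gate s.ρ (a * q₁)) (gate Hmix (a * q₁))) := by
    have eG : gate Hmix (a * q₁) = gate (flaw L) a := by rw [eHm, gate_gate]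
    rw [eG]
    have d₁ : ∀ j'', DECAtT z (a * q₁ * s.mean) j'' s.M (gate s.ρ (a * q₁)) := by
      intro j''
      exact decAtT_gate_of_sdec s.M s.ρ s.x₁ (a * q₁) z hx₁0.le haq0 haq1.le (mul_lt_one_aux haq1.le hx₁0.le hx₁1)
        (by rw [hzv]; exact mul_le_mul_of_nonneg_left hvx₁ haq0.le) ρ0 ρM ρ1 ρta hS₁ j''
    have d₂ : ∀ j'', DECAtT z (a * fmean L) j'' (ftop L) (gate (flaw L) a) := by
      intro j''
      have := decAtT_gate_of_sdec (ftop L) (flaw L) x a z hx0.le ha0 ha1 (mul_lt_one_aux ha1 hx0.le hx1) le_rfl f0 fM f1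
        fta hSL j''
      rwa [fmn] at this
    have hjj : j < s.M + ftop L := by simp only [ftop] at hj; omega
    have hC := convClosedT_holds z (a * q₁ * s.mean) (a * fmean L) s.M (ftop L) j _ _ hz0 hz1 g₁0 g₁M g₁1 g₂0 g₂M g₂1 hjj
      (fun k _ _ => d₁ k) (fun k _ _ => d₂ k)
    have e : a * q₁ * s.mean + a * fmean L = TE := by rw [hTEdef]; ring
    rwa [e] at hC
  -- term U: the mixture of the components, each ONE oracle call at the uniform floor `v`
  have hUE : ∀ c ∈ (Finset.univ : Finset C), 0 < lam c →
      DECAtT z TE j (s.M + ftop L) (gate (lconv s.M (ftop L) s.ρ (flaw (cmp c))) (a * q₁)) := by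
    intro c _ hc
    have hK : ∀ t ∈ cmp c, 0 < t.q ∧ t.q ≤ 1 ∧ TreeBuiltN t.x₁ t.n t.M t.ρ ∧ v ≤ t.q * t.x₁ := by
      intro t ht
      obtain ⟨i, hi, rfl⟩ := (mem_subRegate L (E c) _ t).1 ht
      obtain ⟨_, _, _, iT, _⟩ := hget i
      obtain ⟨ho0, ho1, hfl⟩ := ho c hc i hi
      refine ⟨ho0, ho1, iT, ?_⟩
      show v ≤ o c i * (L.get i).x₁
      rw [hvdef, div_le_iff₀ hq0]
      calc x ≤ q₁ * (o c i * (L.get i).x₁) := hfl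
        _ = o c i * (L.get i).x₁ * q₁ := by ring
    have hKlaw : ∀ t ∈ cmp c, 0 ≤ t.q ∧ t.q ≤ 1 ∧ (∀ h, 0 ≤ t.ρ h) ∧ (∀ h, t.M < h → t.ρ h = 0) ∧
        ∑ h ∈ Finset.range (t.M + 1), t.ρ h = 1 := by
      intro t ht
      obtain ⟨tq0, tq1, tT, _⟩ := hK t ht
      obtain ⟨_, _, t0, tM, t1, _⟩ := tT.lawFacts
      exact ⟨tq0.le, tq1, t0, tM, t1⟩
    obtain ⟨nE, hnE, hTc⟩ := treeBuiltN_flaw_weak hv0 hv1 (cmp c) hK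
    obtain ⟨_, _, c1, cmn⟩ := flaw_facts_weak (cmp c) hKlaw
    have hsv : TreeBuiltN v s.n s.M s.ρ := TreeBuiltN.mono hT hv0 hvx₁
    have hconv : TreeBuiltN v (s.n + nE) (s.M + ftop (cmp c)) (lconv s.M (ftop (cmp c)) s.ρ (flaw (cmp c))) :=
      TreeBuiltN.conv hsv hTc
    have hSE : SDEC v (s.M + ftop (cmp c)) (lconv s.M (ftop (cmp c)) s.ρ (flaw (cmp c))) :=
      hO v (s.n + nE) _ _ (by have := hgatesE c; simp only [fgates]; omega) hconv
    obtain ⟨_, _, F0, FM, F1, Fta⟩ := hconv.lawFacts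
    have hmeanE : ∑ h ∈ Finset.range (s.M + ftop (cmp c) + 1), (h : ℝ) * lconv s.M (ftop (cmp c)) s.ρ (flaw (cmp c)) h
        = s.mean + fmean (cmp c) := by
      rw [sum_mul_lconv _ _ _ _ ρ1 c1, cmn]
      rfl
    have d := decAtT_gate_of_sdec (s.M + ftop (cmp c)) _ v (a * q₁) z hv0.le haq0 haq1.le (mul_lt_one_aux haq1.le hv0.le hv1)
      (le_of_eq hzv) F0 FM F1 Fta hSE j
    rw [hmeanE] at d
    -- the component's gated mean dominates the common target
    have hTle : TE ≤ a * q₁ * (s.mean + fmean (cmp c)) := by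
      have hm := hmean c hc
      have : a * fmean L ≤ a * (q₁ * fmean (cmp c)) := mul_le_mul_of_nonneg_left hm ha0.le
      rw [hTEdef]; nlinarith
    have d' := decAtT_antitone_target hTle d
    have eF : gate (lconv s.M (ftop L) s.ρ (flaw (cmp c))) (a * q₁) = gate (lconv s.M (ftop (cmp c)) s.ρ (flaw (cmp c))) (a * q₁) := by
      have : lconv s.M (ftop L) s.ρ (flaw (cmp c)) = lconv s.M (ftop (cmp c)) s.ρ (flaw (cmp c)) :=
        funext fun h => lconv_top_right_of_le s.M (ftop (cmp c)) (ftop L) s.ρ (flaw (cmp c)) (htopE c) (flaw_eq_zero_of_lt (cmp c)) h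
      rw [this]
    rw [eF]
    exact decAtT_mono_top d' (by have := htopE c; omega)
  have hU : DECAtT z TE j (s.M + ftop L) (gate (lconv s.M (ftop L) s.ρ (gate Hmix (q₁ / q₁))) (a * q₁)) := by
    rw [div_self hq0.ne', gate_one]
    have e : gate (lconv s.M (ftop L) s.ρ Hmix) (a * q₁)
        = fun h => ∑ c ∈ (Finset.univ : Finset C), lam c * gate (lconv s.M (ftop L) s.ρ (flaw (cmp c))) (a * q₁) h := by
      funext h
      have e1 : lconv s.M (ftop L) s.ρ Hmix = fun k => ∑ c ∈ (Finset.univ : Finset C), lam c * lconv s.M (ftop L) s.ρ (flaw (cmp c)) k :=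
        funext fun k => lconv_fsum_right Finset.univ s.M (ftop L) lam s.ρ (fun c => flaw (cmp c)) k
      rw [e1, gate_fsum_mix Finset.univ lam _ (a * q₁) hlam1 h]
    rw [e]
    exact decAtT_mixture_finset Finset.univ lam _ (fun c _ => hlam0 c) hlam1 hUE
  -- the two-root split with equal root gates `(q₁, q₁)` and the mixture
  set w₀ : ℝ := (1 - q₁) / (1 - a * q₁) with hw₀def
  have hw₀0 : 0 ≤ w₀ := div_nonneg (by linarith) (by linarith)
  have hw₀1 : w₀ ≤ 1 := by
    rw [hw₀def, div_le_one (by linarith)]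
    have : a * q₁ ≤ 1 * q₁ := mul_le_mul_of_nonneg_right ha1 hq0.le
    linarith
  have mix := decAtT_mixture w₀ hw₀0 hw₀1 hP hU
  have e : gate (flaw (s :: L)) a
      = fun h => w₀ * lconv s.M (ftop L) (gate s.ρ (a * q₁)) (gate Hmix (a * q₁)) h
          + (1 - w₀) * gate (lconv s.M (ftop L) s.ρ (gate Hmix (q₁ / q₁))) (a * q₁) h := by
    funext h
    have eF : flaw (s :: L) = lconv s.M (ftop L) (gate s.ρ q₁) (gate Hmix q₁) := by
      show lconv (ftop L) s.M (flaw L) (gate s.ρ s.q) = _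
      rw [lconv_comm, eHm]
    rw [eF, hw₀def]
    exact twoRoot_gateCoupling s.M (ftop L) s.ρ Hmix q₁ q₁ a ρM HmixM hq0.ne' (by linarith) h
  obtain ⟨_, _, _, tmn⟩ := flaw_facts (s :: L) hsL
  have htop : ftop (s :: L) = s.M + ftop L := by simp only [ftop]; omega
  have hEmean : ∑ h ∈ Finset.range (ftop (s :: L) + 1), (h : ℝ) * gate (flaw (s :: L)) a h = TE := by
    rw [sum_mul_gate, tmn, hTEdef]
    simp only [fmean]
    ring
  rw [decAt_iff_decAtT, hEmean, e, htop]
  exact mix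

/-- **THE HEAVY-SINGLE SIBLING STEP FROM AN ADMISSIBLE MIXTURE (SDEC form)**: same hypotheses for every outer gate ⟹
`SDEC x (ftop (s :: L)) (flaw (s :: L))`. [this work] -/
theorem sdec_flaw_heavySingle_of_mixture {x : ℝ} (hx0 : 0 < x) (hx1 : x < 1) (s : Sib) (L : List Sib)
    (hs : s.TreeOK x) (hL : ∀ t ∈ L, t.TreeOK x)
    (hO : ∀ (x' : ℝ) (n' M' : ℕ) (μ' : ℕ → ℝ), n' < fgates (s :: L) → TreeBuiltN x' n' M' μ' → SDEC x' M' μ')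
    {C : Type*} [Fintype C] (lam : C → ℝ) (E : C → Finset (Fin L.length)) (o : C → Fin L.length → ℝ)
    (hlam0 : ∀ c, 0 ≤ lam c) (hlam1 : ∑ c, lam c = 1)
    (ho : ∀ c, 0 < lam c → ∀ i ∈ E c, 0 < o c i ∧ o c i ≤ 1 ∧ x ≤ s.q * (o c i * (L.get i).x₁))
    (hmean : ∀ c, 0 < lam c → fmean L ≤ s.q * fmean (subRegate L (E c) (o c)))
    (hmix : ∀ h, s.q * ∑ c, lam c * flaw (subRegate L (E c) (o c)) h = flaw L h - (1 - s.q) * (if h = 0 then 1 else 0)) :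
    SDEC x (ftop (s :: L)) (flaw (s :: L)) := by
  intro a ha0 ha1 j hj
  exact decAt_gate_flaw_heavySingle_of_mixture hx0 hx1 s L hs hL hO lam E o hlam0 hlam1 ho hmean hmix ha0 ha1 j hj

/-! ### The law identity from the pattern equations (the moment problem) -/

/-- **THE MIXTURE IDENTITY IS A FINITE SET OF PATTERN EQUATIONS.**  If for every set of positions `A`
`q₁·Σ_c λ_c·[A ⊆ E_c]·Π_{i∈A} o^c_i·Π_{i∈E_c∖A}(1 − o^c_i) = Π_{i∈A} qᵢ·Π_{i∉A}(1 − qᵢ) − (1 − q₁)·[A = ∅]`, then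
`q₁·Σ_c λ_c·flaw (L|_{E_c}^{o^c}) = flaw L − (1 − q₁)·δ₀` pointwise (by census-1's `flaw_pattern` / `flaw_subRegate`). [this work] -/
theorem mixture_identity_of_patterns (L : List Sib) (q₁ : ℝ) {C : Type*} [Fintype C] (lam : C → ℝ)
    (E : C → Finset (Fin L.length)) (o : C → Fin L.length → ℝ)
    (hpat : ∀ A : Finset (Fin L.length),
      q₁ * ∑ c, lam c * (if A ⊆ E c then (∏ i ∈ A, o c i) * ∏ i ∈ E c \ A, (1 - o c i) else 0)
        = (∏ i ∈ A, (L.get i).q) * (∏ i ∈ Finset.univ \ A, (1 - (L.get i).q)) - (1 - q₁) * (if A = ∅ then 1 else 0)) (h : ℕ) :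
    q₁ * ∑ c, lam c * flaw (subRegate L (E c) (o c)) h = flaw L h - (1 - q₁) * (if h = 0 then 1 else 0) := by
  classical
  -- each component law over ALL position sets, with the indicator `[A ⊆ E_c]`
  have ec : ∀ c, flaw (subRegate L (E c) (o c)) h =
      ∑ A ∈ (Finset.univ : Finset (Fin L.length)).powerset,
        (if A ⊆ E c then (∏ i ∈ A, o c i) * ∏ i ∈ E c \ A, (1 - o c i) else 0) * patLaw L A h := by
    intro c
    rw [flaw_subRegate]
    symm
    rw [← Finset.sum_subset (Finset.powerset_mono.2 (Finset.subset_univ (E c)))]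
    · refine Finset.sum_congr rfl fun A hA => ?_
      rw [if_pos (Finset.mem_powerset.1 hA)]
    · intro A _ hA
      rw [if_neg (fun hh => hA (Finset.mem_powerset.2 hh)), zero_mul]
  -- collect the coefficient of each pattern law
  have e1 : ∑ c, lam c * flaw (subRegate L (E c) (o c)) h =
      ∑ A ∈ (Finset.univ : Finset (Fin L.length)).powerset,
        (∑ c, lam c * (if A ⊆ E c then (∏ i ∈ A, o c i) * ∏ i ∈ E c \ A, (1 - o c i) else 0)) * patLaw L A h := by
    simp_rw [ec, Finset.mul_sum]
    rw [Finset.sum_comm]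
    refine Finset.sum_congr rfl fun A _ => ?_
    rw [Finset.sum_mul]
    exact Finset.sum_congr rfl fun c _ => by ring
  have eB : ∀ A ∈ (Finset.univ : Finset (Fin L.length)).powerset,
      q₁ * ((∑ c, lam c * (if A ⊆ E c then (∏ i ∈ A, o c i) * ∏ i ∈ E c \ A, (1 - o c i) else 0)) * patLaw L A h)
        = ((∏ i ∈ A, (L.get i).q) * ∏ i ∈ Finset.univ \ A, (1 - (L.get i).q)) * patLaw L A h
          - (1 - q₁) * ((if A = ∅ then 1 else 0) * patLaw L A h) := by
    intro A _
    rw [← mul_assoc, hpat A]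
    ring
  rw [e1, Finset.mul_sum, Finset.sum_congr rfl eB, Finset.sum_sub_distrib, ← flaw_pattern L h, ← Finset.mul_sum]
  simp_rw [boole_mul]
  rw [Finset.sum_ite_eq' ((Finset.univ : Finset (Fin L.length)).powerset) ∅ (fun A => patLaw L A h),
    if_pos (Finset.empty_mem_powerset _), patLaw_empty]

/-- **THE HEAVY-SINGLE SIBLING STEP FROM A SOLUTION OF THE PATTERN MOMENT PROBLEM.**  As `sdec_flaw_heavySingle_of_mixture`, with the law identity
replaced by the `2^{|L|}` pattern equations of `mixture_identity_of_patterns` (`q₁ = s.q`). [this work] -/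
theorem sdec_flaw_heavySingle_of_patterns {x : ℝ} (hx0 : 0 < x) (hx1 : x < 1) (s : Sib) (L : List Sib)
    (hs : s.TreeOK x) (hL : ∀ t ∈ L, t.TreeOK x)
    (hO : ∀ (x' : ℝ) (n' M' : ℕ) (μ' : ℕ → ℝ), n' < fgates (s :: L) → TreeBuiltN x' n' M' μ' → SDEC x' M' μ')
    {C : Type*} [Fintype C] (lam : C → ℝ) (E : C → Finset (Fin L.length)) (o : C → Fin L.length → ℝ)
    (hlam0 : ∀ c, 0 ≤ lam c) (hlam1 : ∑ c, lam c = 1)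
    (ho : ∀ c, 0 < lam c → ∀ i ∈ E c, 0 < o c i ∧ o c i ≤ 1 ∧ x ≤ s.q * (o c i * (L.get i).x₁))
    (hmean : ∀ c, 0 < lam c → fmean L ≤ s.q * fmean (subRegate L (E c) (o c)))
    (hpat : ∀ A : Finset (Fin L.length),
      s.q * ∑ c, lam c * (if A ⊆ E c then (∏ i ∈ A, o c i) * ∏ i ∈ E c \ A, (1 - o c i) else 0)
        = (∏ i ∈ A, (L.get i).q) * (∏ i ∈ Finset.univ \ A, (1 - (L.get i).q)) - (1 - s.q) * (if A = ∅ then 1 else 0)) :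
    SDEC x (ftop (s :: L)) (flaw (s :: L)) :=
  sdec_flaw_heavySingle_of_mixture hx0 hx1 s L hs hL hO lam E o hlam0 hlam1 ho hmean
    (mixture_identity_of_patterns L s.q lam E o hpat)

end LawDec
end Quant
end Summit.CriticalPhenomena.PercolationContinuityZ3.Theorems
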